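import Summits.QuantumFields.YangMills.Theorems.BalabanLadderNTClassicalShadowGaugeFix
import HarnessLib

/-!
# Crux `NT` (stmt-QuantumFields-19353), stub `stub_refpkgT : RefPkgT`: THE CLASSICAL SHADOW, XI — «ground states = ONE orbit modulo gauge» gives the
# orbit-sum hypotheses of the orbit test, with the orbit sums of ONE minimiser as the constants

Helper file (`--supports stmt-QuantumFields-19353`) of the fleet lead prover of crux `NT` (unit `ym-spine-19353-p1`, GEN 15); sequel of
`…ClassicalShadowOrbit` (p601276), `…LRO` (p609695), `…ReflectionBox` (p610593), `…GaugeFix` (p612015).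

WHY.  The orbit test (`tendsto_kerCov_of_orbit`, `orbitCov_le_of_e2osc[_depthOne]`) and the kill-path hypothesis `ClassicalOrbitCovFloorUnbounded`
ask that the ORBIT SUMS `Σᵢ dens_x(γᵢ U)`, `Σᵢ dens_x(γᵢ U)·dens_y(γᵢ U)` be CONSTANT on the ground states of the frustrated box.  What a classical
analysis (or the kit) naturally delivers is different in form: ONE minimiser `A` and the statement that EVERY ground state is a symmetry image of `A`
up to a lattice gauge transformation, `GS(η) ⊆ {g·(γⱼ A)}`.  This file proves that the latter gives the former for any finite family `γ` that is
closed under composition up to re-indexing and normalises the gauge group, with the constants READ OFF `A`: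

* **`orbitSum_eq_of_oneOrbitModGauge`** — abstract: `Σᵢ O(γᵢ U) = Σᵢ O(γᵢ A)` for every gauge-invariant `O` and every `U = g·(γⱼ A)`;
* **`orbitSums_dens_of_oneOrbitModGauge`**, **`orbitSums_dens_mul_of_oneOrbitModGauge`** — the hypotheses `h₁`/`h₂`/`h₁₂` of the orbit test on
  `cubeMinimisers`, with `M₁ = Σᵢ dens_x(γᵢ A)`, `M₁₂ = Σᵢ dens_x(γᵢ A) dens_y(γᵢ A)`: the floor of `orbitCov_le_of_e2osc_depthOne` becomes the ORBIT
  COVARIANCE OF THE DENSITY FIELD OF ONE MINIMISER — the number the kit prints;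
* gauge normalisation of the tree's symmetry maps (hypothesis `hgauge`): `configShift_gaugeTransformZd'`, **`boxTimeReflect_gaugeTransformZd`**,
  `relabelConfig_edgePerm_gaugeTransformZd`, **`boxAxisReflect_gaugeTransformZd`**, and closure under composition `comp_gaugeTransformZd_of`.

So the classical kill-path of clause 2 now reads, end to end in the tree: a family of cubes `b → ∞`, exteriors `η_b`, finite symmetry families (permutations /
midplane reflections, gauge-fixed where the exterior is symmetric only up to colour rotation), ONE minimiser `A_b` each with `GS(η_b) = Γ·A_b mod gauge`, and
orbit covariances of the density fields of the `A_b` with `min d⁴(1+‖y−x‖)⁴|Cov_Γ| → ∞` ⇒ `ClassicalOrbitCovFloorUnbounded` ⇒ `¬` clause 2 (every unit, every `C₂`).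
The two variational inputs (`GS = Γ·A mod gauge`; unboundedness along `b`) remain hypotheses.  Nothing about NT; not Clay.
-/

set_option autoImplicit false

noncomputable section

open MeasureTheory Filter Topology
open Literature.MathematicalPhysics.QuantumFieldTheory Literature.MathematicalPhysics.QuantumLattice
open Literature.Probability.LatticeModels
open Summit.QuantumFields.YangMills.Cruxes.OSLegsFromFemtoAndGap.DlrCollarTransfer
open Summit.QuantumFields.YangMills.Cruxes.UVSeamRec.BoundaryLawPenetration

namespace Summit.QuantumFields.YangMills.Cruxes.NT.ClassicalShadow

/-! ## §1 The abstract orbit-closure lemma -/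

section Abstract

variable {G : Type} [Group G] {ι : Type} [Fintype ι]

/-- **Orbit sums over a composition-closed, gauge-normalising family are constant on an orbit modulo gauge.**  Let `γᵢ` (`i : ι`, finite) be
maps of the configuration space such that (closure) for every `j` there is a re-indexing `e` with `γ_k ∘ γ_j = γ_{e k}` for all `k`, and (normalisation)
every `γᵢ` carries gauge transforms to gauge transforms.  Then for every gauge-invariant observable `O` and every configuration of the form
`U = g·(γⱼ A)`: `Σᵢ O(γᵢ U) = Σᵢ O(γᵢ A)`. [folklore] -/
theorem orbitSum_eq_of_oneOrbitModGauge (γ : ι → LGConfig 4 G → LGConfig 4 G)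
    (hmul : ∀ j : ι, ∃ e : ι ≃ ι, ∀ (k : ι) (U : LGConfig 4 G), γ k (γ j U) = γ (e k) U)
    (hgauge : ∀ (i : ι) (g : Site 4 → G), ∃ g' : Site 4 → G, ∀ U : LGConfig 4 G, γ i (gaugeTransformZd g U) = gaugeTransformZd g' (γ i U))
    {O : LGConfig 4 G → ℝ} (hO : IsZdGaugeInvariant O) (A : LGConfig 4 G) (j : ι) (g : Site 4 → G) :
    ∑ i, O (γ i (gaugeTransformZd g (γ j A))) = ∑ i, O (γ i A) := by
  obtain ⟨e, he⟩ := hmul j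
  have h1 : ∀ i, O (γ i (gaugeTransformZd g (γ j A))) = O (γ (e i) A) := fun i => by
    obtain ⟨g', hg'⟩ := hgauge i g
    rw [hg', hO g', he]
  simp_rw [h1]
  exact e.sum_comp (fun k => O (γ k A))

/-- The same for a set all of whose elements are gauge transforms of `γ`-images of `A`. [folklore] -/
theorem orbitSum_const_of_oneOrbitModGauge (γ : ι → LGConfig 4 G → LGConfig 4 G)
    (hmul : ∀ j : ι, ∃ e : ι ≃ ι, ∀ (k : ι) (U : LGConfig 4 G), γ k (γ j U) = γ (e k) U)
    (hgauge : ∀ (i : ι) (g : Site 4 → G), ∃ g' : Site 4 → G, ∀ U : LGConfig 4 G, γ i (gaugeTransformZd g U) = gaugeTransformZd g' (γ i U))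
    {O : LGConfig 4 G → ℝ} (hO : IsZdGaugeInvariant O) {A : LGConfig 4 G} {S : Set (LGConfig 4 G)}
    (hS : ∀ U ∈ S, ∃ (j : ι) (g : Site 4 → G), U = gaugeTransformZd g (γ j A)) :
    ∀ U ∈ S, ∑ i, O (γ i U) = ∑ i, O (γ i A) := by
  intro U hU
  obtain ⟨j, g, rfl⟩ := hS U hU
  exact orbitSum_eq_of_oneOrbitModGauge γ hmul hgauge hO A j g

/-- Closure of the normalisation property under composition. [folklore] -/
theorem comp_gaugeTransformZd_of {T₁ T₂ : LGConfig 4 G → LGConfig 4 G}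
    (h₁ : ∀ g : Site 4 → G, ∃ g' : Site 4 → G, ∀ U : LGConfig 4 G, T₁ (gaugeTransformZd g U) = gaugeTransformZd g' (T₁ U))
    (h₂ : ∀ g : Site 4 → G, ∃ g' : Site 4 → G, ∀ U : LGConfig 4 G, T₂ (gaugeTransformZd g U) = gaugeTransformZd g' (T₂ U)) :
    ∀ g : Site 4 → G, ∃ g' : Site 4 → G, ∀ U : LGConfig 4 G, (T₁ ∘ T₂) (gaugeTransformZd g U) = gaugeTransformZd g' ((T₁ ∘ T₂) U) := by
  intro g
  obtain ⟨g₂, hg₂⟩ := h₂ g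
  obtain ⟨g₁, hg₁⟩ := h₁ g₂
  exact ⟨g₁, fun U => by simp only [Function.comp_apply, hg₂, hg₁]⟩

end Abstract

/-! ## §2 The tree's symmetry maps normalise the gauge group -/

section Normalise

variable {G : Type} [Group G] [MeasurableSpace G]

/-- Translations normalise gauge transformations: `τ_v (g·U) = (g(· − v))·(τ_v U)`. [folklore] -/
theorem configShift_gaugeTransformZd' (v : Site 4) (g : Site 4 → G) (U : LGConfig 4 G) :
    Literature.MathematicalPhysics.QuantumLattice.configShift v (gaugeTransformZd g U) =
      gaugeTransformZd (fun y => g (y - v)) (Literature.MathematicalPhysics.QuantumLattice.configShift v U) := by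
  funext e
  simp only [Literature.MathematicalPhysics.QuantumLattice.configShift_apply, gaugeTransformZd, add_sub_right_comm]

/-- **The midplane time reflection normalises gauge transformations.** [folklore] -/
theorem boxTimeReflect_gaugeTransformZd (c : Fin 4 → ℤ) (b : ℕ) (g : Site 4 → G) (U : LGConfig 4 G) :
    boxTimeReflect c b (gaugeTransformZd g U) =
      gaugeTransformZd (fun y => (g ∘ siteReflect) (y - Pi.single 0 (2 * c 0 + b - 1))) (boxTimeReflect c b U) := by
  show Literature.MathematicalPhysics.QuantumLattice.configShift (Pi.single 0 (2 * c 0 + (b : ℤ) - 1)) (cfgReflect (gaugeTransformZd g U)) = _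
  rw [cfgReflect_gaugeTransformZd, configShift_gaugeTransformZd']
  rfl

/-- Coordinate permutations normalise gauge transformations: `σ·(g·U) = (g ∘ σ⁻¹)·(σ·U)`. [folklore] -/
theorem relabelConfig_edgePerm_gaugeTransformZd (σ : Equiv.Perm (Fin 4)) (g : Site 4 → G) (U : LGConfig 4 G) :
    relabelConfig (edgePerm σ) (gaugeTransformZd g U) = gaugeTransformZd (g ∘ sitePerm σ.symm) (relabelConfig (edgePerm σ) U) := by
  funext e
  obtain ⟨x, i⟩ := e
  simp only [relabelConfig_apply, edgePerm_symm_apply, gaugeTransformZd, Function.comp_apply, sitePerm_add, sitePerm_single]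

/-- **The midplane reflection of axis `k` normalises gauge transformations.** [folklore] -/
theorem boxAxisReflect_gaugeTransformZd (k : Fin 4) (c : Fin 4 → ℤ) (b : ℕ) :
    ∀ g : Site 4 → G, ∃ g' : Site 4 → G, ∀ U : LGConfig 4 G, boxAxisReflect k c b (gaugeTransformZd g U) = gaugeTransformZd g' (boxAxisReflect k c b U) := by
  have hσ : ∀ g : Site 4 → G, ∃ g' : Site 4 → G, ∀ U : LGConfig 4 G,
      relabelConfig (edgePerm (Equiv.swap (0 : Fin 4) k)) (gaugeTransformZd g U) =
        gaugeTransformZd g' (relabelConfig (edgePerm (Equiv.swap (0 : Fin 4) k)) U) :=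
    fun g => ⟨_, fun U => relabelConfig_edgePerm_gaugeTransformZd _ g U⟩
  have hT : ∀ g : Site 4 → G, ∃ g' : Site 4 → G, ∀ U : LGConfig 4 G,
      boxTimeReflect (sitePerm (Equiv.swap (0 : Fin 4) k) c) b (gaugeTransformZd g U) =
        gaugeTransformZd g' (boxTimeReflect (sitePerm (Equiv.swap (0 : Fin 4) k) c) b U) :=
    fun g => ⟨_, fun U => boxTimeReflect_gaugeTransformZd _ b g U⟩
  exact comp_gaugeTransformZd_of hσ (comp_gaugeTransformZd_of hT hσ)

omit [MeasurableSpace G] in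
/-- Gauge-fixed maps normalise gauge transformations as well (`g₀⁻¹·` is itself a gauge transformation). [folklore] -/
theorem gaugeFix_gaugeTransformZd (g₀ : Site 4 → G) {T : LGConfig 4 G → LGConfig 4 G}
    (hT : ∀ g : Site 4 → G, ∃ g' : Site 4 → G, ∀ U : LGConfig 4 G, T (gaugeTransformZd g U) = gaugeTransformZd g' (T U)) :
    ∀ g : Site 4 → G, ∃ g' : Site 4 → G, ∀ U : LGConfig 4 G,
      (gaugeTransformZd g₀⁻¹ ∘ T) (gaugeTransformZd g U) = gaugeTransformZd g' ((gaugeTransformZd g₀⁻¹ ∘ T) U) := by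
  refine comp_gaugeTransformZd_of (fun g => ⟨g₀⁻¹ * g * g₀, fun U => ?_⟩) hT
  funext e
  simp only [gaugeTransformZd, Pi.mul_apply, Pi.inv_apply]
  group

end Normalise

/-! ## §3 The orbit-sum hypotheses of the orbit test from «ground states = one orbit modulo gauge» -/

section GroundStates

variable {G : Type} [Group G] [TopologicalSpace G] [IsTopologicalGroup G] [CompactSpace G]
  [MeasurableSpace G] [BorelSpace G] (r : LatticeRep G) {ι : Type} [Fintype ι]

/-- **`h₁`/`h₂` of the orbit test from one orbit modulo gauge**: if every ground state of the cube `(c, b)` with exterior `η` is a gauge transform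
of a `γ`-image of ONE configuration `A`, then the orbit sum of the density at any site is constant on the ground states, equal to its value on `A`.
[folklore] -/
theorem orbitSums_dens_of_oneOrbitModGauge (c : Fin 4 → ℤ) (b : ℕ) (η : LGConfig 4 G) (γ : ι → LGConfig 4 G → LGConfig 4 G)
    (hmul : ∀ j : ι, ∃ e : ι ≃ ι, ∀ (k : ι) (U : LGConfig 4 G), γ k (γ j U) = γ (e k) U)
    (hgauge : ∀ (i : ι) (g : Site 4 → G), ∃ g' : Site 4 → G, ∀ U : LGConfig 4 G, γ i (gaugeTransformZd g U) = gaugeTransformZd g' (γ i U))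
    {A : LGConfig 4 G}
    (hGS : ∀ ζ ∈ cubeMinimisers G r c b η, ∃ (j : ι) (g : Site 4 → G), glueWith (cubeEdges c b) ζ η = gaugeTransformZd g (γ j A))
    (x : Fin 4 → ℤ) :
    ∀ ζ ∈ cubeMinimisers G r c b η, ∑ i, dens G r x (γ i (glueWith (cubeEdges c b) ζ η)) = ∑ i, dens G r x (γ i A) := by
  intro ζ hζ
  obtain ⟨j, g, hj⟩ := hGS ζ hζ
  rw [hj]
  exact orbitSum_eq_of_oneOrbitModGauge γ hmul hgauge (fun g' U => dens_gaugeTransformZd r g' x U) A j g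

/-- **`h₁₂` of the orbit test from one orbit modulo gauge** (products of densities at two sites). [folklore] -/
theorem orbitSums_dens_mul_of_oneOrbitModGauge (c : Fin 4 → ℤ) (b : ℕ) (η : LGConfig 4 G) (γ : ι → LGConfig 4 G → LGConfig 4 G)
    (hmul : ∀ j : ι, ∃ e : ι ≃ ι, ∀ (k : ι) (U : LGConfig 4 G), γ k (γ j U) = γ (e k) U)
    (hgauge : ∀ (i : ι) (g : Site 4 → G), ∃ g' : Site 4 → G, ∀ U : LGConfig 4 G, γ i (gaugeTransformZd g U) = gaugeTransformZd g' (γ i U))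
    {A : LGConfig 4 G}
    (hGS : ∀ ζ ∈ cubeMinimisers G r c b η, ∃ (j : ι) (g : Site 4 → G), glueWith (cubeEdges c b) ζ η = gaugeTransformZd g (γ j A))
    (x y : Fin 4 → ℤ) :
    ∀ ζ ∈ cubeMinimisers G r c b η,
      ∑ i, dens G r x (γ i (glueWith (cubeEdges c b) ζ η)) * dens G r y (γ i (glueWith (cubeEdges c b) ζ η)) =
        ∑ i, dens G r x (γ i A) * dens G r y (γ i A) := by
  intro ζ hζ
  obtain ⟨j, g, hj⟩ := hGS ζ hζ
  rw [hj]
  exact orbitSum_eq_of_oneOrbitModGauge γ hmul hgauge (O := fun U => dens G r x U * dens G r y U)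
    (fun g' U => by simp only [dens_gaugeTransformZd]) A j g

/-- **The orbit test with ONE minimiser.**  Under the one-orbit-mod-gauge hypothesis, the zero-temperature conditional covariance of a
`γ`-symmetric kernel tends to the ORBIT COVARIANCE OF THE DENSITY FIELD OF `A`:
`kerCov^η_β(dens_x, dens_y) → (1/k)Σᵢ dens_x(γᵢA) dens_y(γᵢA) − ((1/k)Σᵢ dens_x(γᵢA))((1/k)Σᵢ dens_y(γᵢA))`. [folklore] -/
theorem tendsto_kerCov_of_oneOrbitModGauge [Nonempty ι] (c : Fin 4 → ℤ) (b : ℕ) (η : LGConfig 4 G) (γ : ι → LGConfig 4 G → LGConfig 4 G)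
    (hγ : ∀ i, Continuous (γ i))
    (hmul : ∀ j : ι, ∃ e : ι ≃ ι, ∀ (k : ι) (U : LGConfig 4 G), γ k (γ j U) = γ (e k) U)
    (hgauge : ∀ (i : ι) (g : Site 4 → G), ∃ g' : Site 4 → G, ∀ U : LGConfig 4 G, γ i (gaugeTransformZd g U) = gaugeTransformZd g' (γ i U))
    (hsymm : ∀ (β : ℝ) (i : ι) (F : LGConfig 4 G → ℝ), Continuous F → kerE G r β c b η (F ∘ γ i) = kerE G r β c b η F)
    {A : LGConfig 4 G}
    (hGS : ∀ ζ ∈ cubeMinimisers G r c b η, ∃ (j : ι) (g : Site 4 → G), glueWith (cubeEdges c b) ζ η = gaugeTransformZd g (γ j A))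
    (x y : Fin 4 → ℤ) :
    Tendsto (fun β : ℝ => kerCov G r β c b η (dens G r x) (dens G r y)) atTop
      (𝓝 ((∑ i, dens G r x (γ i A) * dens G r y (γ i A)) / Fintype.card ι -
        (∑ i, dens G r x (γ i A)) / Fintype.card ι * ((∑ i, dens G r y (γ i A)) / Fintype.card ι))) :=
  tendsto_kerCov_of_orbit r c b η γ hγ
    (orbitSums_dens_of_oneOrbitModGauge r c b η γ hmul hgauge hGS x)
    (orbitSums_dens_of_oneOrbitModGauge r c b η γ hmul hgauge hGS y)
    (orbitSums_dens_mul_of_oneOrbitModGauge r c b η γ hmul hgauge hGS x y)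
    (fun β i => hsymm β i _ (continuous_dens r x)) (fun β i => hsymm β i _ (continuous_dens r y))
    (fun β i => hsymm β i _ ((continuous_dens r x).mul (continuous_dens r y)))

end GroundStates

/-! ## §4 Closure UP TO GAUGE (gauge-fixed families)

For a gauge-FIXED family `γᵢ = gᵢ⁻¹· ∘ Tᵢ` (`…GaugeFix`) the compositions `γ_k ∘ γ_j` agree with a member of the family only up to a gauge
transformation.  The orbit-sum lemma survives verbatim with this weaker closure hypothesis, because the observables are gauge invariant. -/

section ModGauge

variable {G : Type} [Group G] {ι : Type} [Fintype ι]

/-- **Orbit sums with closure up to gauge.**  If for every `j` there is a re-indexing `e` such that each `γ_k ∘ γ_j` is a gauge transform of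
`γ_{e k}` (pointwise), every `γᵢ` normalises gauge transformations, and `O` is gauge invariant, then `Σᵢ O(γᵢ (g·γⱼ A)) = Σᵢ O(γᵢ A)`. [folklore] -/
theorem orbitSum_eq_of_oneOrbitModGauge' (γ : ι → LGConfig 4 G → LGConfig 4 G)
    (hmul : ∀ j : ι, ∃ e : ι ≃ ι, ∀ (k : ι) (U : LGConfig 4 G), ∃ h : Site 4 → G, γ k (γ j U) = gaugeTransformZd h (γ (e k) U))
    (hgauge : ∀ (i : ι) (g : Site 4 → G), ∃ g' : Site 4 → G, ∀ U : LGConfig 4 G, γ i (gaugeTransformZd g U) = gaugeTransformZd g' (γ i U))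
    {O : LGConfig 4 G → ℝ} (hO : IsZdGaugeInvariant O) (A : LGConfig 4 G) (j : ι) (g : Site 4 → G) :
    ∑ i, O (γ i (gaugeTransformZd g (γ j A))) = ∑ i, O (γ i A) := by
  obtain ⟨e, he⟩ := hmul j
  have h1 : ∀ i, O (γ i (gaugeTransformZd g (γ j A))) = O (γ (e i) A) := fun i => by
    obtain ⟨g', hg'⟩ := hgauge i g
    obtain ⟨h, hh⟩ := he i A
    rw [hg', hO g', hh, hO h]
  simp_rw [h1]
  exact e.sum_comp (fun k => O (γ k A))

variable [TopologicalSpace G] [IsTopologicalGroup G] [CompactSpace G] [MeasurableSpace G] [BorelSpace G] (r : LatticeRep G)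

/-- **`h₁`/`h₂` of the orbit test from one orbit modulo gauge, closure up to gauge.** [folklore] -/
theorem orbitSums_dens_of_oneOrbitModGauge' (c : Fin 4 → ℤ) (b : ℕ) (η : LGConfig 4 G) (γ : ι → LGConfig 4 G → LGConfig 4 G)
    (hmul : ∀ j : ι, ∃ e : ι ≃ ι, ∀ (k : ι) (U : LGConfig 4 G), ∃ h : Site 4 → G, γ k (γ j U) = gaugeTransformZd h (γ (e k) U))
    (hgauge : ∀ (i : ι) (g : Site 4 → G), ∃ g' : Site 4 → G, ∀ U : LGConfig 4 G, γ i (gaugeTransformZd g U) = gaugeTransformZd g' (γ i U))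
    {A : LGConfig 4 G}
    (hGS : ∀ ζ ∈ cubeMinimisers G r c b η, ∃ (j : ι) (g : Site 4 → G), glueWith (cubeEdges c b) ζ η = gaugeTransformZd g (γ j A))
    (x : Fin 4 → ℤ) :
    ∀ ζ ∈ cubeMinimisers G r c b η, ∑ i, dens G r x (γ i (glueWith (cubeEdges c b) ζ η)) = ∑ i, dens G r x (γ i A) := by
  intro ζ hζ
  obtain ⟨j, g, hj⟩ := hGS ζ hζ
  rw [hj]
  exact orbitSum_eq_of_oneOrbitModGauge' γ hmul hgauge (fun g' U => dens_gaugeTransformZd r g' x U) A j g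

/-- **`h₁₂` of the orbit test from one orbit modulo gauge, closure up to gauge.** [folklore] -/
theorem orbitSums_dens_mul_of_oneOrbitModGauge' (c : Fin 4 → ℤ) (b : ℕ) (η : LGConfig 4 G) (γ : ι → LGConfig 4 G → LGConfig 4 G)
    (hmul : ∀ j : ι, ∃ e : ι ≃ ι, ∀ (k : ι) (U : LGConfig 4 G), ∃ h : Site 4 → G, γ k (γ j U) = gaugeTransformZd h (γ (e k) U))
    (hgauge : ∀ (i : ι) (g : Site 4 → G), ∃ g' : Site 4 → G, ∀ U : LGConfig 4 G, γ i (gaugeTransformZd g U) = gaugeTransformZd g' (γ i U))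
    {A : LGConfig 4 G}
    (hGS : ∀ ζ ∈ cubeMinimisers G r c b η, ∃ (j : ι) (g : Site 4 → G), glueWith (cubeEdges c b) ζ η = gaugeTransformZd g (γ j A))
    (x y : Fin 4 → ℤ) :
    ∀ ζ ∈ cubeMinimisers G r c b η,
      ∑ i, dens G r x (γ i (glueWith (cubeEdges c b) ζ η)) * dens G r y (γ i (glueWith (cubeEdges c b) ζ η)) =
        ∑ i, dens G r x (γ i A) * dens G r y (γ i A) := by
  intro ζ hζ
  obtain ⟨j, g, hj⟩ := hGS ζ hζ
  rw [hj]
  exact orbitSum_eq_of_oneOrbitModGauge' γ hmul hgauge (O := fun U => dens G r x U * dens G r y U)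
    (fun g' U => by simp only [dens_gaugeTransformZd]) A j g

/-- **The orbit test with ONE minimiser, closure up to gauge** (the form a gauge-fixed symmetry family `γᵢ = gᵢ⁻¹· ∘ Tᵢ` satisfies):
`kerCov^η_β(dens_x, dens_y) →` the orbit covariance of the density field of `A`. [folklore] -/
theorem tendsto_kerCov_of_oneOrbitModGauge' [Nonempty ι] (c : Fin 4 → ℤ) (b : ℕ) (η : LGConfig 4 G) (γ : ι → LGConfig 4 G → LGConfig 4 G)
    (hγ : ∀ i, Continuous (γ i))
    (hmul : ∀ j : ι, ∃ e : ι ≃ ι, ∀ (k : ι) (U : LGConfig 4 G), ∃ h : Site 4 → G, γ k (γ j U) = gaugeTransformZd h (γ (e k) U))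
    (hgauge : ∀ (i : ι) (g : Site 4 → G), ∃ g' : Site 4 → G, ∀ U : LGConfig 4 G, γ i (gaugeTransformZd g U) = gaugeTransformZd g' (γ i U))
    (hsymm : ∀ (β : ℝ) (i : ι) (F : LGConfig 4 G → ℝ), Continuous F → kerE G r β c b η (F ∘ γ i) = kerE G r β c b η F)
    {A : LGConfig 4 G}
    (hGS : ∀ ζ ∈ cubeMinimisers G r c b η, ∃ (j : ι) (g : Site 4 → G), glueWith (cubeEdges c b) ζ η = gaugeTransformZd g (γ j A))
    (x y : Fin 4 → ℤ) :
    Tendsto (fun β : ℝ => kerCov G r β c b η (dens G r x) (dens G r y)) atTop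
      (𝓝 ((∑ i, dens G r x (γ i A) * dens G r y (γ i A)) / Fintype.card ι -
        (∑ i, dens G r x (γ i A)) / Fintype.card ι * ((∑ i, dens G r y (γ i A)) / Fintype.card ι))) :=
  tendsto_kerCov_of_orbit r c b η γ hγ
    (orbitSums_dens_of_oneOrbitModGauge' r c b η γ hmul hgauge hGS x)
    (orbitSums_dens_of_oneOrbitModGauge' r c b η γ hmul hgauge hGS y)
    (orbitSums_dens_mul_of_oneOrbitModGauge' r c b η γ hmul hgauge hGS x y)
    (fun β i => hsymm β i _ (continuous_dens r x)) (fun β i => hsymm β i _ (continuous_dens r y))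
    (fun β i => hsymm β i _ ((continuous_dens r x).mul (continuous_dens r y)))

end ModGauge

end Summit.QuantumFields.YangMills.Cruxes.NT.ClassicalShadow

end
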